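import Literature.Probability.RandomPlanarGeometry.SkorokhodSelection
import Mathlib.MeasureTheory.Measure.Real
import Mathlib.MeasureTheory.Measure.Typeclasses.Probability
import HarnessLib

/-!
# Skorokhod embedding: martingales on a finite probability space, atom by atom

Topic `Probability/RandomPlanarGeometry`, sub-namespace `SkorokhodEmbedding` (support file for
Lawler–Schramm–Werner (2004), Lemma 3.8 / Durrett (2019), Thm. 8.2.1). Everything here is PROVED;
no named fact is introduced.

The Skorokhod embedding of a martingale is used in [LSW04] only for martingales living on a
**finite** probability space (the loop-erased walk of a finite grid domain, Thm. 3.7; the UST Peano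
path of a finite domain, Thm. 4.4), with the filtration generated by the successive initial
pieces of the random path. We fix that setting in an elementary, choice-free form:

* `MartingaleData Ω Λ`: a probability measure `P` on a finite type `Ω`, labels
  `H n : Ω → Λ` (the "history up to step `n`"; the filtration is `σ(H n)`), the process
  `M n : Ω → ℝ` and the increment bound `δ`;
* `MartingaleData.IsValid`: histories refine (`H n` determines `H k`, `k ≤ n`), `M n` is a
  function of `H n`, `M 0 = 0`, the **martingale property atom by atom**
  `∑_{ω : H n ω = l} P{ω} (M (n+1) ω - M n ω) = 0`, and `|M (n+1) - M n| ≤ 2δ` (the hypotheses of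
  [LSW04] Lemma 3.8: "`(M_n)_{n ≤ N}` is an `(𝓕_n)` martingale with `‖M_n - M_{n-1}‖_∞ ≤ 2δ` and
  `M_0 = 0`");
* the **conditional law of the next step given an atom** `{H n = l}`: its children
  `children n l` (values of `H (n+1)` on the atom), their conditional probabilities `pc n l c`,
  the atom values `Mval n l` of `M n` and the increments `xc n l c`, with the facts consumed by the
  embedding: the children partition the atom (`sum_atom_eq_sum_children`), `∑_c pc = 1`,
  the **centring** `∑_c pc · xc = 0` (`sum_pc_mul_xc`), `|xc| ≤ 2δ`, and `xc` is the actual increment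
  of `M` on the child atom (`xc_eq_sub`).

## References

* G. F. Lawler, O. Schramm, W. Werner, Ann. Probab. 32 (2004), Lemma 3.8.
* R. Durrett, *Probability: Theory and Examples*, 5th ed. (2019), Thm. 8.2.1 (conditional law
  `μ_k(S_0,…,S_{k-1}; ·)` of the increment given the past).
-/

noncomputable section

open MeasureTheory Finset
open scoped ENNReal

namespace Literature.Probability.RandomPlanarGeometry.SkorokhodEmbedding

/-- **Martingale data on a finite probability space**: the law `P`, the histories `H n`
(generating the filtration), the process `M n` and the increment bound `δ`. [LSW04] Lemma 3.8;
Durrett (2019), Thm. 8.2.1. [cite: LawlerSchrammWerner2004, Lemma 3.8] -/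
structure MartingaleData (Ω Λ : Type*) [MeasurableSpace Ω] where
  /-- the probability law of the finite sample space -/
  P : Measure Ω
  /-- the history up to step `n` (the filtration is generated by `H n`) -/
  H : ℕ → Ω → Λ
  /-- the martingale -/
  M : ℕ → Ω → ℝ
  /-- half the uniform bound on the increments: `|M (n+1) - M n| ≤ 2δ` -/
  δ : ℝ

namespace MartingaleData

variable {Ω Λ : Type*} [Fintype Ω] [MeasurableSpace Ω] [DecidableEq Λ] (D : MartingaleData Ω Λ)

/-! ### Atoms, children, conditional probabilities -/

/-- The atom `{H n = l}` of the history `σ`-algebra at step `n`. [folklore] -/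
def atom (n : ℕ) (l : Λ) : Finset Ω := univ.filter fun ω ↦ D.H n ω = l

/-- Membership in an atom. [folklore] -/
@[simp] theorem mem_atom {n : ℕ} {l : Λ} {ω : Ω} : ω ∈ D.atom n l ↔ D.H n ω = l := by
  simp [atom]

/-- The probability `P[H n = l]` of an atom, as a finite sum of point masses. [folklore] -/
def pH (n : ℕ) (l : Λ) : ℝ := ∑ ω ∈ D.atom n l, D.P.real {ω}

/-- The children of the atom `{H n = l}`: the values of `H (n+1)` on it. [folklore] -/
def children (n : ℕ) (l : Λ) : Finset Λ := (D.atom n l).image (D.H (n + 1))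

/-- The conditional probability of the child `c` given the atom `{H n = l}` (junk if the atom is
null). Durrett (2019), Thm. 8.2.1 (`μ_k(S_0, …, S_{k-1}; ·)`). [folklore] -/
def pc (n : ℕ) (l c : Λ) : ℝ := D.pH (n + 1) c / D.pH n l

/-- The value of `M n` on the atom `{H n = l}`, written choice-free as the `P`-average over the
atom (junk `0` on a null atom). [folklore] -/
def Mval (n : ℕ) (l : Λ) : ℝ := (∑ ω ∈ D.atom n l, D.P.real {ω} * D.M n ω) / D.pH n l

/-- The increment `M (n+1) - M n` on the child atom `{H (n+1) = c}` of `{H n = l}` (junk `0` on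
a null child). Durrett (2019), Thm. 8.2.1 (the support of `μ_k`). [folklore] -/
def xc (n : ℕ) (l c : Λ) : ℝ := if D.pH (n + 1) c = 0 then 0 else D.Mval (n + 1) c - D.Mval n l

/-- **Validity of martingale data**: a probability law; refining histories; `M n` a function of
`H n`; `M 0 = 0`; the martingale property atom by atom; increments bounded by `2δ`.
[LSW04] Lemma 3.8 (hypotheses); Durrett (2019), Thm. 8.2.1. [cite: LawlerSchrammWerner2004, Lemma 3.8] -/
structure IsValid : Prop where
  /-- `P` is a probability measure -/
  prob : IsProbabilityMeasure D.P
  /-- the history at step `n` determines the history at every earlier step -/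
  refine : ∀ ⦃k n : ℕ⦄ ⦃ω ω' : Ω⦄, k ≤ n → D.H n ω = D.H n ω' → D.H k ω = D.H k ω'
  /-- `M n` is measurable with respect to `σ(H n)` -/
  adapted : ∀ ⦃n : ℕ⦄ ⦃ω ω' : Ω⦄, D.H n ω = D.H n ω' → D.M n ω = D.M n ω'
  /-- `M 0 = 0` -/
  zero : ∀ ω, D.M 0 ω = 0
  /-- the martingale property, atom by atom -/
  martingale : ∀ (n : ℕ) (l : Λ), ∑ ω ∈ D.atom n l, D.P.real {ω} * (D.M (n + 1) ω - D.M n ω) = 0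
  /-- uniformly bounded increments -/
  bdd : ∀ (n : ℕ) (ω : Ω), |D.M (n + 1) ω - D.M n ω| ≤ 2 * D.δ

variable {D}

/-! ### The children partition the atom -/

/-- A child atom lies inside its parent atom (refinement). [folklore] -/
theorem atom_succ_subset_atom (hD : D.IsValid) {n : ℕ} {l c : Λ} (hc : c ∈ D.children n l) :
    D.atom (n + 1) c ⊆ D.atom n l := by
  intro ω hω
  rw [mem_atom] at hω ⊢
  obtain ⟨ω₀, hω₀, hc₀⟩ := mem_image.1 hc
  rw [mem_atom] at hω₀
  rw [← hω₀]
  exact hD.refine (Nat.le_succ n) (by rw [hω, hc₀])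

/-- The fibre of `H (n+1)` over a child, inside the parent atom, is the child atom. [folklore] -/
theorem filter_atom_eq_atom_succ (hD : D.IsValid) {n : ℕ} {l c : Λ} (hc : c ∈ D.children n l) :
    (D.atom n l).filter (fun ω ↦ D.H (n + 1) ω = c) = D.atom (n + 1) c := by
  ext ω
  simp only [mem_filter, mem_atom]
  constructor
  · exact fun h ↦ h.2
  · intro h
    exact ⟨(D.mem_atom).1 (atom_succ_subset_atom hD hc ((D.mem_atom).2 h)), h⟩

/-- **The children partition the atom**: a sum over the atom `{H n = l}` is the sum over its
children `c` of the sums over the child atoms `{H (n+1) = c}`. [folklore] -/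
theorem sum_atom_eq_sum_children (hD : D.IsValid) (n : ℕ) (l : Λ) (f : Ω → ℝ) :
    ∑ ω ∈ D.atom n l, f ω = ∑ c ∈ D.children n l, ∑ ω ∈ D.atom (n + 1) c, f ω := by
  rw [← sum_fiberwise_of_maps_to (s := D.atom n l) (t := D.children n l) (g := D.H (n + 1))
    (fun ω hω ↦ mem_image_of_mem _ hω) f]
  exact sum_congr rfl fun c hc ↦ by rw [filter_atom_eq_atom_succ hD hc]

/-! ### Atom probabilities -/

/-- `P[H n = l] ≥ 0`. [folklore] -/
theorem pH_nonneg (n : ℕ) (l : Λ) : 0 ≤ D.pH n l := sum_nonneg fun _ _ ↦ measureReal_nonneg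

/-- The atom probability is the measure of the atom. [folklore] -/
theorem pH_eq_measureReal [MeasurableSingletonClass Ω] (hD : D.IsValid) (n : ℕ) (l : Λ) :
    D.pH n l = D.P.real {ω | D.H n ω = l} := by
  haveI := hD.prob
  rw [pH, sum_measureReal_singleton]
  congr 1
  ext ω
  simp [atom]

/-- **`P[H n = l] = ∑_{children c} P[H (n+1) = c]`**. [folklore] -/
theorem pH_eq_sum_children (hD : D.IsValid) (n : ℕ) (l : Λ) :
    D.pH n l = ∑ c ∈ D.children n l, D.pH (n + 1) c :=
  sum_atom_eq_sum_children hD n l _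

/-- The conditional child probabilities are nonnegative. [folklore] -/
theorem pc_nonneg (n : ℕ) (l c : Λ) : 0 ≤ D.pc n l c :=
  div_nonneg (pH_nonneg _ _) (pH_nonneg _ _)

/-- **The conditional child probabilities sum to one** on a non-null atom. [folklore] -/
theorem sum_pc_eq_one (hD : D.IsValid) {n : ℕ} {l : Λ} (hl : D.pH n l ≠ 0) :
    ∑ c ∈ D.children n l, D.pc n l c = 1 := by
  simp only [pc]
  rw [← sum_div, ← pH_eq_sum_children hD, div_self hl]

/-- A null child has conditional probability zero. [folklore] -/
theorem pc_eq_zero_of_pH_eq_zero {n : ℕ} {l c : Λ} (hc : D.pH (n + 1) c = 0) : D.pc n l c = 0 := by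
  rw [pc, hc, zero_div]

/-! ### Atom values of the martingale and increments -/

/-- On a non-null atom the average `Mval n l` is the (constant) value of `M n`. [folklore] -/
theorem Mval_eq (hD : D.IsValid) {n : ℕ} {l : Λ} (hl : D.pH n l ≠ 0) {ω : Ω} (hω : D.H n ω = l) :
    D.Mval n l = D.M n ω := by
  rw [Mval, div_eq_iff hl, pH, mul_sum]
  refine sum_congr rfl fun ω' hω' ↦ ?_
  rw [mem_atom] at hω'
  rw [hD.adapted (hω'.trans hω.symm), mul_comm]

/-- **The increment `xc` is the actual increment of `M` on a non-null child atom.**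
Durrett (2019), Thm. 8.2.1. [folklore] -/
theorem xc_eq_sub (hD : D.IsValid) {n : ℕ} {l c : Λ} (hc : c ∈ D.children n l)
    (hcp : D.pH (n + 1) c ≠ 0) {ω : Ω} (hω : D.H (n + 1) ω = c) :
    D.xc n l c = D.M (n + 1) ω - D.M n ω := by
  have hlω : D.H n ω = l :=
    (D.mem_atom).1 (atom_succ_subset_atom hD hc ((D.mem_atom).2 hω))
  have hl : D.pH n l ≠ 0 := by
    intro h0
    have hle : D.pH (n + 1) c ≤ D.pH n l := by
      rw [pH_eq_sum_children hD n l]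
      exact single_le_sum (f := fun c' ↦ D.pH (n + 1) c') (fun c' _ ↦ pH_nonneg _ _) hc
    exact hcp (le_antisymm (hle.trans h0.le) (pH_nonneg _ _))
  rw [xc, if_neg hcp, Mval_eq hD hcp hω, Mval_eq hD hl hlω]

/-- **`|xc| ≤ 2δ`** (bounded increments; the junk value `0` on null children also complies when
`δ ≥ 0`). [LSW04] Lemma 3.8 (`‖M_n - M_{n-1}‖_∞ ≤ 2δ`). [cite: LawlerSchrammWerner2004, Lemma 3.8] -/
theorem abs_xc_le (hD : D.IsValid) (hδ : 0 ≤ D.δ) (n : ℕ) (l c : Λ) (hc : c ∈ D.children n l) :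
    |D.xc n l c| ≤ 2 * D.δ := by
  by_cases hcp : D.pH (n + 1) c = 0
  · rw [xc, if_pos hcp, abs_zero]; linarith
  · obtain ⟨ω₀, -, hc₀⟩ := mem_image.1 hc
    rw [xc_eq_sub hD hc hcp hc₀]
    exact hD.bdd n ω₀

/-- **Centring of the conditional law**: `∑_c pc · xc = 0` on a non-null atom — the martingale
property read atom by atom. Durrett (2019), Thm. 8.2.1 ("the mean of the conditional distribution
is `0` almost surely"). [cite: Durrett2019, Thm. 8.2.1] -/
theorem sum_pc_mul_xc (hD : D.IsValid) {n : ℕ} {l : Λ} (hl : D.pH n l ≠ 0) :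
    ∑ c ∈ D.children n l, D.pc n l c * D.xc n l c = 0 := by
  -- each term is `(1 / pH n l) ∑_{ω ∈ atom c} P{ω} (M (n+1) ω - M n ω)`
  have hterm : ∀ c ∈ D.children n l, D.pc n l c * D.xc n l c =
      (∑ ω ∈ D.atom (n + 1) c, D.P.real {ω} * (D.M (n + 1) ω - D.M n ω)) / D.pH n l := by
    intro c hc
    by_cases hcp : D.pH (n + 1) c = 0
    · -- a null child: both sides vanish
      rw [pc_eq_zero_of_pH_eq_zero hcp, zero_mul]
      have : ∑ ω ∈ D.atom (n + 1) c, D.P.real {ω} * (D.M (n + 1) ω - D.M n ω) = 0 := by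
        have hz : ∀ ω ∈ D.atom (n + 1) c, D.P.real {ω} = 0 := by
          have := (sum_eq_zero_iff_of_nonneg (fun ω _ ↦ measureReal_nonneg)).1 hcp
          exact this
        exact sum_eq_zero fun ω hω ↦ by rw [hz ω hω, zero_mul]
      rw [this, zero_div]
    · rw [pc, div_mul_eq_mul_div, div_left_inj' hl, pH, sum_mul]
      refine sum_congr rfl fun ω hω ↦ ?_
      rw [mem_atom] at hω
      rw [xc_eq_sub hD hc hcp hω]
  rw [sum_congr rfl hterm, ← sum_div, ← sum_atom_eq_sum_children hD n l, hD.martingale n l, zero_div]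

/-- Centring in the form consumed by the mixture identity of `SkorokhodSelection`:
`∑_c pc · xc = 0` whenever the atom is non-null. [folklore] -/
theorem sum_pc_mul_xc' (hD : D.IsValid) {n : ℕ} {l : Λ} (hl : D.pH n l ≠ 0) :
    ∑ c ∈ D.children n l, D.pc n l c * D.xc n l c = 0 := sum_pc_mul_xc hD hl

/-! ### The pair weights and levels of the embedding step -/

/-- The **pair weights of the embedding step** at the atom `{H n = l}`: Durrett's mixture
(8.1.1) for the conditional law of the increment, indexed by pairs of children
(`SkorokhodSelection.pairWeight`). [cite: Durrett2019, Thm. 8.1.1] -/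
def stepWeight (n : ℕ) (l : Λ) : Λ × Λ → ℝ := pairWeight (D.children n l) (D.pc n l) (D.xc n l)

/-- The set of pairs of children of an atom. [folklore] -/
def stepPairs (n : ℕ) (l : Λ) : Finset (Λ × Λ) := D.children n l ×ˢ D.children n l

/-- **The pair selected by the uniform variable `u`** at the atom `{H n = l}` (junk `(l, l)` on
an atom without children). Durrett (2019), proof of Thm. 8.1.1 (the randomisation `(U, V)`).
[cite: Durrett2019, Thm. 8.1.1] -/
def selPair (n : ℕ) (l : Λ) (u : ℝ) : Λ × Λ := wselect (D.stepPairs n l) (D.stepWeight n l) (l, l) u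

/-- The lower level `x i` of a pair `(i, j)`. [folklore] -/
def lo (n : ℕ) (l : Λ) (ij : Λ × Λ) : ℝ := D.xc n l ij.1

/-- The upper level `x j` of a pair `(i, j)`. [folklore] -/
def hi (n : ℕ) (l : Λ) (ij : Λ × Λ) : ℝ := D.xc n l ij.2

/-- **The child produced by a pair and an exit value**: the first component if the exit value is
its level, else the second (for the zero pair `(i, i)` always `i`). Durrett (2019), proof of
Thm. 8.1.1 (`B(T_{U,V}) ∈ {U, V}`). [folklore] -/
def childOf (n : ℕ) (l : Λ) (ij : Λ × Λ) (v : ℝ) : Λ := if v = D.lo n l ij then ij.1 else ij.2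

/-- The step weights are nonnegative. [folklore] -/
theorem stepWeight_nonneg (n : ℕ) (l : Λ) (ij : Λ × Λ) : 0 ≤ D.stepWeight n l ij :=
  pairWeight_nonneg _ (fun c _ ↦ pc_nonneg n l c) ij

/-- **The step weights sum to one** on a non-null atom. [cite: Durrett2019, Thm. 8.1.1] -/
theorem sum_stepWeight_eq_one (hD : D.IsValid) {n : ℕ} {l : Λ} (hl : D.pH n l ≠ 0) :
    ∑ ij ∈ D.stepPairs n l, D.stepWeight n l ij = 1 :=
  sum_pairWeight_eq_one (fun c _ ↦ pc_nonneg n l c) (sum_pc_eq_one hD hl) (sum_pc_mul_xc hD hl)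

/-- **The mixture identity of the embedding step** on a non-null atom: for every `φ`,
`∑_{pairs} stepWeight · pairAverage φ = ∑_{children} pc · φ`. [cite: Durrett2019, Thm. 8.1.1] -/
theorem sum_stepWeight_mul_pairAverage (hD : D.IsValid) {n : ℕ} {l : Λ} (hl : D.pH n l ≠ 0)
    (φ : Λ → ℝ) :
    ∑ ij ∈ D.stepPairs n l, D.stepWeight n l ij * pairAverage (D.xc n l) ij φ =
      ∑ c ∈ D.children n l, D.pc n l c * φ c :=
  sum_pairWeight_mul_pairAverage (fun c _ ↦ pc_nonneg n l c) (sum_pc_mul_xc hD hl) φ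

/-- **The levels of a selected pair**: a pair of positive weight has `lo ≤ 0 ≤ hi`, and it is
either a genuine pair `lo < 0 < hi` or a zero pair `i = j`, `lo = hi = 0`. [folklore] -/
theorem levels_of_stepWeight_ne_zero {n : ℕ} {l : Λ} {ij : Λ × Λ} (h : D.stepWeight n l ij ≠ 0) :
    (ij.1 ∈ D.children n l ∧ ij.2 ∈ D.children n l) ∧
      ((D.lo n l ij < 0 ∧ 0 < D.hi n l ij) ∨ (ij.1 = ij.2 ∧ D.lo n l ij = 0 ∧ D.hi n l ij = 0)) := by
  obtain ⟨hmem, hcase⟩ := pairWeight_ne_zero_imp h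
  refine ⟨hmem, ?_⟩
  rcases hcase with h' | ⟨heq, h0⟩
  · exact Or.inl h'
  · refine Or.inr ⟨heq, h0, ?_⟩
    change D.xc n l ij.2 = 0
    rw [← heq]
    exact h0

/-- The levels of a pair of positive weight lie in `[-2δ, 2δ]` (`δ ≥ 0`). [folklore] -/
theorem abs_levels_le (hD : D.IsValid) (hδ : 0 ≤ D.δ) {n : ℕ} {l : Λ} {ij : Λ × Λ}
    (h : D.stepWeight n l ij ≠ 0) : |D.lo n l ij| ≤ 2 * D.δ ∧ |D.hi n l ij| ≤ 2 * D.δ := by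
  obtain ⟨⟨h1, h2⟩, -⟩ := levels_of_stepWeight_ne_zero h
  exact ⟨abs_xc_le hD hδ n l _ h1, abs_xc_le hD hδ n l _ h2⟩

end MartingaleData

end Literature.Probability.RandomPlanarGeometry.SkorokhodEmbedding
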